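import Literature.NumberTheory.Transcendental.GaGmSlices
import Mathlib.Algebra.Polynomial.Roots
import HarnessLib

/-!
# Coordinate sections of a connected subgroup of `G = 𝔾ₐ × 𝔾ₘⁿ`: level subgroups, generic
# section points, the section polynomial

Topic `Literature/NumberTheory/Transcendental`. Second helper file (after `GaGmSlices.lean`) for
the general-rank lower bound of the box multiplicity `mult_{D₀,D₁}(V × T_A)` of a connected
algebraic subgroup of `G` (the obstruction degree `𝓗(G*; D)` of Nesterenko 2003, Prop. 5.1,
formula (5.7); Philippon 1986, §3), which is proved by cutting an irreducible closed subgroup `H`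
with the box-degree-one hypersurface
`F = ∏_{c good} ∏_{i} (X_c - x_c(σ_{c,i}))` (all coordinates `c : Fin (n+1)` at once, `c = 0` the
additive one) and applying the tree's Bézout section inequality `GaGm.sum_mult_section_le`.
Everything here is PROVED; no named facts. Coordinates are indexed uniformly by `c : Fin (n+1)`
through `GaGm.coord` (`coord g 0 = x`, `coord g h.succ = y_h`).

* The additive line `{y = 1} = 𝔾ₐ × {1}` is irreducible closed (`isIrred_addLine`).
* Level subgroups `K_c = {g ∈ H ; coord_c g = coord_c e}` (`exists_subgroup_coe_eq_level`, closed,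
  `= H ∩ Z(X_c - coord_c e)`), and `coord_c (σ g) = coord_c σ` for `g ∈ K_c`
  (`coord_mul_eq_of_coord_eq`).
* Generic section points: in one coordinate (`exists_points_coord`: injective `coord_c`-values in
  the infinite image avoiding a finite set) and sequentially over all coordinates
  (`exists_section_points`: later families avoid the finitely many `coord_c`-values of the
  earlier families' level cosets).
* The section polynomial `F`: `F ∈ Box D₀ D₁ 1`, `evalAt F`, `F(e) ≠ 0`, and its zero set
  (`sectionPoly_mem_Box`, `evalAt_sectionPoly`, `mem_zeroSet_sectionPoly_iff`).

## References

* P. Philippon, *Lemmes de zéros dans les groupes algébriques commutatifs*, Bull. Soc. Math.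
  France 114 (1986), 355–383, §3 (Prop. 3.3, Lemme 3.4). [Philippon1986]
* Yu. V. Nesterenko, *Linear forms in logarithms of rational numbers*, LNM 1819 (2003), §5.1,
  (5.7) and Prop. 5.1. [Nesterenko2003]
* A. Borel, *Linear Algebraic Groups*, GTM 126 (1991), §8.5. [Borel1991]
-/

noncomputable section

open MvPolynomial Module
open scoped Pointwise

namespace Literature.NumberTheory.Transcendental

namespace GaGm

variable {n : ℕ}

/-! ### Coordinates of the identity and of products -/

/-- `coord e 0 = 0`. [cite: Borel1991, §8.5] -/
@[simp] theorem coord_one_zero : coord (1 : GaGm n) 0 = 0 := by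
  rw [coord_zero]; rfl

/-- `coord e h.succ = 1`. [cite: Borel1991, §8.5] -/
@[simp] theorem coord_one_succ (h : Fin n) : coord (1 : GaGm n) h.succ = 1 := by
  rw [coord_succ]; rfl

/-- The `c`-th coordinate of `σ·g` equals that of `σ` when the `c`-th coordinate of `g` is that of
`e` (`x` is additive, the `y_h` are multiplicative). [cite: Borel1991, §8.5] -/
theorem coord_mul_eq_of_coord_eq {g : GaGm n} {c : Fin (n + 1)} (hg : coord g c = coord (1 : GaGm n) c)
    (σ : GaGm n) : coord (σ * g) c = coord σ c := by
  revert hg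
  refine Fin.cases ?_ (fun h => ?_) c
  · intro hg
    rw [coord_one_zero, coord_zero] at hg
    rw [coord_zero, coord_zero, Prod.fst_mul, toAdd_mul, hg, add_zero]
  · intro hg
    rw [coord_one_succ, coord_succ] at hg
    rw [coord_succ, coord_succ, Prod.snd_mul, Pi.mul_apply, Units.val_mul, hg, mul_one]

/-- The `c`-th coordinate of `g⁻¹` is that of `e` when the `c`-th coordinate of `g` is.
[cite: Borel1991, §8.5] -/
theorem coord_inv_eq_of_coord_eq {g : GaGm n} {c : Fin (n + 1)} (hg : coord g c = coord (1 : GaGm n) c) :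
    coord g⁻¹ c = coord (1 : GaGm n) c := by
  have h := coord_mul_eq_of_coord_eq hg g⁻¹
  rw [inv_mul_cancel] at h
  exact h.symm

/-! ### The additive line `𝔾ₐ × {1}` is irreducible -/

/-- The points `(x, 1)` of the additive line. [cite: Borel1991, §8.5] -/
theorem mem_addLine_iff {g : GaGm n} : g ∈ {g : GaGm n | g.2 = 1} ↔ g.2 = 1 := Iff.rfl

/-- **The additive line `{y = 1} = 𝔾ₐ × {1} ⊂ G(ℂ)` is an irreducible closed set**: it is the
zero set of the `Y_h - 1`, and its vanishing ideal is the kernel of the substitution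
`X ↦ X, Y_h ↦ 1` into the domain `ℂ[X]` (a polynomial vanishing at every `(x, 1)` has infinitely
many roots in `x`). [cite: Borel1991, §8.5] -/
theorem isIrred_addLine : IsIrred ({g : GaGm n | g.2 = 1} : Set (GaGm n)) := by
  classical
  -- closed
  have hcl : IsClosedG ({g : GaGm n | g.2 = 1} : Set (GaGm n)) := by
    have heq : ({g : GaGm n | g.2 = 1} : Set (GaGm n)) =
        zeroSet (Set.range fun h : Fin n => (X h.succ - 1 : MvPolynomial (Fin (n + 1)) ℂ)) := by
      ext g
      simp only [Set.mem_setOf_eq, mem_zeroSet_iff, Set.forall_mem_range, evalAt_eq_eval, map_sub,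
        eval_X, map_one, coord_succ, sub_eq_zero, Units.val_eq_one]
      exact ⟨fun h j => by rw [h]; rfl, fun h => funext h⟩
    rw [heq]; exact isClosedG_zeroSet _
  refine ⟨hcl, ?_⟩
  -- the substitution `Y ↦ 1`
  let φ : MvPolynomial (Fin (n + 1)) ℂ →ₐ[ℂ] Polynomial ℂ :=
    aeval (Fin.cases Polynomial.X (fun _ => 1))
  have hφ : ∀ (P : MvPolynomial (Fin (n + 1)) ℂ) (x : ℂ),
      Polynomial.eval x (φ P) = evalAt P ((Multiplicative.ofAdd x, 1) : GaGm n) := by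
    intro P x
    have hfun : (fun i => (Polynomial.aeval x : Polynomial ℂ →ₐ[ℂ] ℂ)
        (Fin.cases Polynomial.X (fun _ => (1 : Polynomial ℂ)) i)) =
        coord ((Multiplicative.ofAdd x, 1) : GaGm n) := by
      funext i
      refine Fin.cases ?_ (fun h => ?_) i
      · simp [coord_zero]
      · simp [coord_succ]
    calc Polynomial.eval x (φ P)
        = ((Polynomial.aeval x : Polynomial ℂ →ₐ[ℂ] ℂ).comp
            (aeval (Fin.cases Polynomial.X (fun _ => (1 : Polynomial ℂ))))) P := rfl
      _ = aeval (fun i => (Polynomial.aeval x : Polynomial ℂ →ₐ[ℂ] ℂ)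
            (Fin.cases Polynomial.X (fun _ => (1 : Polynomial ℂ)) i)) P := by
          rw [MvPolynomial.comp_aeval]
      _ = evalAt P ((Multiplicative.ofAdd x, 1) : GaGm n) := by
          rw [hfun]; rfl
  have hker : ∀ P : MvPolynomial (Fin (n + 1)) ℂ, P ∈ vanishing ({g : GaGm n | g.2 = 1} : Set (GaGm n)) ↔ φ P = 0 := by
    intro P
    constructor
    · intro hP
      apply Polynomial.eq_zero_of_infinite_isRoot
      refine Set.infinite_of_injective_forall_mem (f := fun x : ℂ => x) (fun a b h => h) fun x => ?_
      change Polynomial.IsRoot (φ P) x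
      rw [Polynomial.IsRoot.def, hφ]
      exact hP _ rfl
    · intro hP g hg
      have hg' : g = ((Multiplicative.ofAdd (Multiplicative.toAdd g.1), 1) : GaGm n) := by
        ext <;> simp [mem_addLine_iff.mp hg]
      rw [hg', ← hφ, hP, Polynomial.eval_zero]
  have hkeq : vanishing ({g : GaGm n | g.2 = 1} : Set (GaGm n)) = RingHom.ker φ.toRingHom := by
    ext P; rw [hker, RingHom.mem_ker]; rfl
  rw [hkeq]
  exact RingHom.ker_isPrime _

/-! ### Level subgroups `K_c = {g ∈ H ; coord_c g = coord_c e}` -/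

/-- The level set `{g ∈ H ; coord_c g = coord_c e}` of the `c`-th coordinate character on a
subgroup `H` is (the carrier of) a subgroup. [cite: Borel1991, §8.5] -/
theorem exists_subgroup_coe_eq_level (H : Subgroup (GaGm n)) (c : Fin (n + 1)) :
    ∃ K : Subgroup (GaGm n),
      (K : Set (GaGm n)) = {g : GaGm n | g ∈ H ∧ coord g c = coord (1 : GaGm n) c} :=
  ⟨{ carrier := {g | g ∈ H ∧ coord g c = coord (1 : GaGm n) c}
     one_mem' := ⟨H.one_mem, rfl⟩
     mul_mem' := fun {a b} ha hb => ⟨H.mul_mem ha.1 hb.1, by rw [coord_mul_eq_of_coord_eq hb.2, ha.2]⟩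
     inv_mem' := fun {a} ha => ⟨H.inv_mem ha.1, coord_inv_eq_of_coord_eq ha.2⟩ }, rfl⟩

/-- The level set is the hypersurface section `H ∩ Z(X_c - coord_c e)`. [cite: Borel1991, §8.5] -/
theorem level_eq_inter_zeroSet (H : Subgroup (GaGm n)) (c : Fin (n + 1)) :
    {g : GaGm n | g ∈ H ∧ coord g c = coord (1 : GaGm n) c} =
      (H : Set (GaGm n)) ∩ zeroSet {(X c - C (coord (1 : GaGm n) c) : MvPolynomial (Fin (n + 1)) ℂ)} := by
  ext g
  simp only [Set.mem_setOf_eq, Set.mem_inter_iff, SetLike.mem_coe, mem_zeroSet_iff, Set.mem_singleton_iff,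
    forall_eq, evalAt_eq_eval, map_sub, eval_X, eval_C, sub_eq_zero]

/-- Level sets of closed subgroups are closed. [cite: Borel1991, §8.5] -/
theorem isClosedG_level (H : Subgroup (GaGm n)) (hH : IsClosedG (H : Set (GaGm n))) (c : Fin (n + 1)) :
    IsClosedG {g : GaGm n | g ∈ H ∧ coord g c = coord (1 : GaGm n) c} := by
  rw [level_eq_inter_zeroSet]
  exact hH.inter (isClosedG_zeroSet _)

/-! ### Generic section points -/

/-- **Generic points in one coordinate.** If the `c`-th coordinate takes infinitely many values on
the subgroup `H`, then for any finite `B ⊂ ℂ` there is a sequence of points of `H` whose `c`-th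
coordinates are pairwise distinct and avoid `B`. [cite: Borel1991, §8.5] -/
theorem exists_points_coord (H : Subgroup (GaGm n)) (c : Fin (n + 1))
    (hinf : ((fun g : GaGm n => coord g c) '' (H : Set (GaGm n))).Infinite) {B : Set ℂ} (hB : B.Finite) :
    ∃ σ : ℕ → GaGm n, (∀ i, σ i ∈ H) ∧ (∀ i i', coord (σ i) c = coord (σ i') c → i = i') ∧
      ∀ i, coord (σ i) c ∉ B := by
  have hA : (((fun g : GaGm n => coord g c) '' (H : Set (GaGm n))) \ B).Infinite := hinf.sdiff hB
  let e := hA.natEmbedding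
  have he : ∀ i, ((e i : ℂ) ∈ (fun g : GaGm n => coord g c) '' (H : Set (GaGm n))) ∧ (e i : ℂ) ∉ B :=
    fun i => (e i).2
  choose σ hσH hσc using fun i => (he i).1
  have hσc' : ∀ i, coord (σ i) c = (e i : ℂ) := hσc
  refine ⟨σ, hσH, fun i i' h => ?_, fun i => ?_⟩
  · rw [hσc', hσc'] at h
    exact e.injective (Subtype.ext h)
  · rw [hσc']; exact (he i).2

/-- For a subgroup with all the points `(x, 1)`, the additive coordinate takes infinitely many values.
[cite: Borel1991, §8.5] -/
theorem infinite_image_coord_zero (H : Subgroup (GaGm n))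
    (hall : ∀ x : ℂ, ((Multiplicative.ofAdd x, 1) : GaGm n) ∈ H) :
    ((fun g : GaGm n => coord g 0) '' (H : Set (GaGm n))).Infinite := by
  have : ((fun g : GaGm n => coord g 0) '' (H : Set (GaGm n))) = Set.univ := by
    refine Set.eq_univ_of_forall fun x => ⟨(Multiplicative.ofAdd x, 1), hall x, ?_⟩
    simp [coord_zero]
  rw [this]
  exact Set.infinite_univ

/-- For an irreducible closed subgroup on which `y_h` is a non-trivial character, the coordinate
`y_h` takes infinitely many values (as complex numbers). [cite: Borel1991, §8.5] -/
theorem infinite_image_coord_succ (H : Subgroup (GaGm n)) (hirr : IsIrred (H : Set (GaGm n))) (h : Fin n)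
    (hh : Pi.single h (1 : ℤ) ∉ charGroup (H : Set (GaGm n))) :
    ((fun g : GaGm n => coord g h.succ) '' (H : Set (GaGm n))).Infinite := by
  have heq : ((fun g : GaGm n => coord g h.succ) '' (H : Set (GaGm n))) =
      (Units.val : ℂˣ → ℂ) '' ((fun g : GaGm n => g.2 h) '' (H : Set (GaGm n))) := by
    rw [Set.image_image]
    refine Set.image_congr' fun g => ?_
    rw [coord_succ]
  rw [heq]
  exact (infinite_image_coord H hirr h hh).image Units.val_injective.injOn

/-- **Sequential generic choice of the section points.** Given the subgroup `H`, a finite set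
`good` of coordinates each taking infinitely many values on `H`, multiplicities `m c`, and
auxiliary sets `K c' ⊆ G(ℂ)`, there are points `σ c i ∈ H` (`c` good, `i < m c`) whose `c`-th
coordinates are pairwise distinct in `i`, differ from `coord_c e`, and such that for two distinct
good coordinates `c ≠ c'` one of the two (the later one in the construction) avoids the
`c`-values of the other's translated sets `σ c' i' · K c'` whenever these are finite in number.
[cite: Philippon1986, §3 Lemme 3.4] -/
theorem exists_section_points (H : Subgroup (GaGm n)) (good : Finset (Fin (n + 1))) (m : Fin (n + 1) → ℕ)
    (hinf : ∀ c ∈ good, ((fun g : GaGm n => coord g c) '' (H : Set (GaGm n))).Infinite)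
    (K : Fin (n + 1) → Set (GaGm n)) :
    ∃ σ : Fin (n + 1) → ℕ → GaGm n,
      (∀ c i, σ c i ∈ H) ∧
      (∀ c ∈ good, ∀ i i', coord (σ c i) c = coord (σ c i') c → i = i') ∧
      (∀ c ∈ good, ∀ i, coord (σ c i) c ≠ coord (1 : GaGm n) c) ∧
      (∀ c ∈ good, ∀ c' ∈ good, c ≠ c' → ∀ i, ∀ i' < m c',
        (((fun g : GaGm n => coord g c) '' (σ c' i' • K c')).Finite →
            coord (σ c i) c ∉ (fun g : GaGm n => coord g c) '' (σ c' i' • K c')) ∨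
        ∀ i'', i < m c → (((fun g : GaGm n => coord g c') '' (σ c i • K c)).Finite →
            coord (σ c' i'') c' ∉ (fun g : GaGm n => coord g c') '' (σ c i • K c))) := by
  classical
  -- `Q k`: a choice for the coordinates `c < k`
  suffices hQ : ∀ k : ℕ, ∃ σ : Fin (n + 1) → ℕ → GaGm n,
      (∀ c i, σ c i ∈ H) ∧
      (∀ c ∈ good, c.val < k → ∀ i i', coord (σ c i) c = coord (σ c i') c → i = i') ∧
      (∀ c ∈ good, c.val < k → ∀ i, coord (σ c i) c ≠ coord (1 : GaGm n) c) ∧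
      (∀ c ∈ good, ∀ c' ∈ good, c'.val < c.val → c.val < k → ∀ i, ∀ i' < m c',
        ((fun g : GaGm n => coord g c) '' (σ c' i' • K c')).Finite →
          coord (σ c i) c ∉ (fun g : GaGm n => coord g c) '' (σ c' i' • K c')) by
    obtain ⟨σ, h1, h2, h3, h4⟩ := hQ (n + 1)
    refine ⟨σ, h1, fun c hc => h2 c hc c.isLt, fun c hc => h3 c hc c.isLt, fun c hc c' hc' hcc' i i' hi' => ?_⟩
    rcases lt_or_gt_of_ne (fun h : c'.val = c.val => hcc' (Fin.ext h).symm) with hlt | hlt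
    · exact Or.inl (h4 c hc c' hc' hlt c.isLt i i' hi')
    · exact Or.inr fun i'' hi => h4 c' hc' c hc hlt c'.isLt i'' i hi
  intro k
  induction k with
  | zero =>
    exact ⟨fun _ _ => 1, fun _ _ => H.one_mem, fun c _ h => absurd h (Nat.not_lt_zero _),
      fun c _ h => absurd h (Nat.not_lt_zero _), fun c _ c' _ _ h => absurd h (Nat.not_lt_zero _)⟩
  | succ k ih =>
    obtain ⟨σ, h1, h2, h3, h4⟩ := ih
    by_cases hk : k < n + 1
    swap
    · -- no new coordinate
      refine ⟨σ, h1, fun c hc _ => h2 c hc (by omega), fun c hc _ => h3 c hc (by omega),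
        fun c hc c' hc' hlt _ => h4 c hc c' hc' hlt (by omega)⟩
    set c₀ : Fin (n + 1) := ⟨k, hk⟩ with hc₀
    by_cases hgood : c₀ ∈ good
    swap
    · -- the new coordinate is not good: nothing to choose
      refine ⟨σ, h1, fun c hc hck => h2 c hc ?_, fun c hc hck => h3 c hc ?_,
        fun c hc c' hc' hlt hck => h4 c hc c' hc' hlt ?_⟩
      all_goals
        rcases Nat.lt_succ_iff_lt_or_eq.mp hck with h | h
        · exact h
        · exact absurd hc fun hc => hgood ((show c = c₀ from Fin.ext h) ▸ hc)
    -- the finite set to avoid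
    let B : Set ℂ := {coord (1 : GaGm n) c₀} ∪
      ⋃ c' ∈ good.filter (fun c' => c'.val < k), ⋃ i' ∈ Finset.range (m c'),
        if ((fun g : GaGm n => coord g c₀) '' (σ c' i' • K c')).Finite then
          (fun g : GaGm n => coord g c₀) '' (σ c' i' • K c') else ∅
    have hB : B.Finite := by
      refine (Set.finite_singleton _).union (Set.Finite.biUnion (Finset.finite_toSet _) fun c' _ => ?_)
      refine Set.Finite.biUnion (Finset.finite_toSet _) fun i' _ => ?_
      split_ifs with hfin
      · exact hfin
      · exact Set.finite_empty
    obtain ⟨τ, hτH, hτinj, hτB⟩ := exists_points_coord H c₀ (hinf c₀ hgood) hB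
    refine ⟨Function.update σ c₀ τ, fun c i => ?_, fun c hc hck => ?_, fun c hc hck i => ?_,
      fun c hc c' hc' hlt hck i i' hi' hfin => ?_⟩
    · by_cases hc : c = c₀
      · subst hc; rw [Function.update_self]; exact hτH i
      · rw [Function.update_of_ne hc]; exact h1 c i
    · by_cases hc' : c = c₀
      · subst hc'; rw [Function.update_self]; exact hτinj
      · rw [Function.update_of_ne hc']
        exact h2 c hc (by rcases Nat.lt_succ_iff_lt_or_eq.mp hck with h | h; exact h; exact absurd (show c = c₀ from Fin.ext h) hc')
    · by_cases hc' : c = c₀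
      · subst hc'; rw [Function.update_self]
        exact fun h => hτB i (Set.mem_union_left _ (Set.mem_singleton_iff.mpr h))
      · rw [Function.update_of_ne hc']
        exact h3 c hc (by rcases Nat.lt_succ_iff_lt_or_eq.mp hck with h | h; exact h; exact absurd (show c = c₀ from Fin.ext h) hc') i
    · -- the avoidance: `c' < c ≤ k`
      have hc'ne : c' ≠ c₀ := fun h => by
        have h' : k < c.val := by rw [h] at hlt; exact hlt
        omega
      rw [Function.update_of_ne hc'ne] at hfin ⊢
      by_cases hcc : c = c₀
      · subst hcc
        rw [Function.update_self]
        intro hmem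
        apply hτB i
        refine Set.mem_union_right _ (Set.mem_iUnion₂.mpr ⟨c', Finset.mem_filter.mpr ⟨hc', hlt⟩, ?_⟩)
        refine Set.mem_iUnion₂.mpr ⟨i', Finset.mem_range.mpr hi', ?_⟩
        rw [if_pos hfin]
        exact hmem
      · rw [Function.update_of_ne hcc]
        have hck' : c.val < k := by
          rcases Nat.lt_succ_iff_lt_or_eq.mp hck with h | h
          · exact h
          · exact absurd (show c = c₀ from Fin.ext h) hcc
        exact h4 c hc c' hc' hlt hck' i i' hi' hfin

/-! ### The section polynomial -/

/-- **Partial degrees of the section polynomial.** For points `σ c i` and multiplicities `m c`, the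
polynomial `F = ∏_{c ∈ good} ∏_{i < m c} (X_c - coord_c(σ c i))` has `deg_{X_c} F ≤ m c`.
[cite: Philippon1986, §3 Lemme 3.4] -/
theorem degreeOf_sectionPoly_le (good : Finset (Fin (n + 1))) (m : Fin (n + 1) → ℕ)
    (σ : Fin (n + 1) → ℕ → GaGm n) (j : Fin (n + 1)) :
    (∏ c ∈ good, ∏ i ∈ Finset.range (m c),
        (X c - C (coord (σ c i) c) : MvPolynomial (Fin (n + 1)) ℂ)).degreeOf j ≤ m j := by
  classical
  refine (degreeOf_prod_le _ _ _).trans ?_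
  have hterm : ∀ c ∈ good, (∏ i ∈ Finset.range (m c),
      (X c - C (coord (σ c i) c) : MvPolynomial (Fin (n + 1)) ℂ)).degreeOf j ≤ if c = j then m j else 0 := by
    intro c _
    refine (degreeOf_prod_le _ _ _).trans ?_
    have : ∀ i ∈ Finset.range (m c),
        (X c - C (coord (σ c i) c) : MvPolynomial (Fin (n + 1)) ℂ).degreeOf j ≤ if c = j then 1 else 0 := by
      intro i _
      refine (degreeOf_sub_le _ _ _).trans ?_
      rw [degreeOf_C, degreeOf_X]
      by_cases h : c = j
      · subst h; simp
      · simp [h, Ne.symm h]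
    refine (Finset.sum_le_sum this).trans ?_
    rw [Finset.sum_const, Finset.card_range, smul_eq_mul]
    split_ifs with h
    · subst h; exact le_of_eq (mul_one _)
    · simp
  refine (Finset.sum_le_sum hterm).trans ?_
  rw [Finset.sum_ite_eq' good j]
  split_ifs <;> simp

/-- The section polynomial lies in `Box D₀ D₁ 1` when `m 0 ≤ D₀` and `m h.succ ≤ D₁`.
[cite: Philippon1986, §3 Lemme 3.4] -/
theorem sectionPoly_mem_Box {D₀ D₁ : ℕ} (good : Finset (Fin (n + 1))) (m : Fin (n + 1) → ℕ)
    (σ : Fin (n + 1) → ℕ → GaGm n) (hm0 : m 0 ≤ D₀) (hm : ∀ h : Fin n, m h.succ ≤ D₁) :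
    (∏ c ∈ good, ∏ i ∈ Finset.range (m c),
        (X c - C (coord (σ c i) c) : MvPolynomial (Fin (n + 1)) ℂ)) ∈ Box (n := n) D₀ D₁ 1 := by
  rw [mem_Box_iff, one_mul, one_mul]
  exact ⟨(degreeOf_sectionPoly_le good m σ 0).trans hm0, fun h => (degreeOf_sectionPoly_le good m σ h.succ).trans (hm h)⟩

/-- The value of the section polynomial at a point. [cite: Philippon1986, §3 Lemme 3.4] -/
theorem evalAt_sectionPoly (good : Finset (Fin (n + 1))) (m : Fin (n + 1) → ℕ)
    (σ : Fin (n + 1) → ℕ → GaGm n) (g : GaGm n) :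
    evalAt (∏ c ∈ good, ∏ i ∈ Finset.range (m c),
        (X c - C (coord (σ c i) c) : MvPolynomial (Fin (n + 1)) ℂ)) g =
      ∏ c ∈ good, ∏ i ∈ Finset.range (m c), (coord g c - coord (σ c i) c) := by
  simp only [evalAt_eq_eval, map_prod, map_sub, eval_X, eval_C]

/-- The zero set of the section polynomial: `F(g) = 0` iff some `coord_c g = coord_c (σ c i)`
(`c` good, `i < m c`). [cite: Philippon1986, §3 Lemme 3.4] -/
theorem evalAt_sectionPoly_eq_zero_iff (good : Finset (Fin (n + 1))) (m : Fin (n + 1) → ℕ)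
    (σ : Fin (n + 1) → ℕ → GaGm n) (g : GaGm n) :
    evalAt (∏ c ∈ good, ∏ i ∈ Finset.range (m c),
        (X c - C (coord (σ c i) c) : MvPolynomial (Fin (n + 1)) ℂ)) g = 0 ↔
      ∃ c ∈ good, ∃ i < m c, coord g c = coord (σ c i) c := by
  rw [evalAt_sectionPoly, Finset.prod_eq_zero_iff]
  refine exists_congr fun c => and_congr_right fun _ => ?_
  rw [Finset.prod_eq_zero_iff]
  constructor
  · rintro ⟨i, hi, h⟩; exact ⟨i, Finset.mem_range.mp hi, sub_eq_zero.mp h⟩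
  · rintro ⟨i, hi, h⟩; exact ⟨i, Finset.mem_range.mpr hi, sub_eq_zero.mpr h⟩

/-- The section polynomial does not vanish at `e` when the chosen values avoid `coord_c e`; in
particular it is not in the vanishing ideal of any subgroup. [cite: Philippon1986, §3 Lemme 3.4] -/
theorem sectionPoly_notMem_vanishing (H : Subgroup (GaGm n)) (good : Finset (Fin (n + 1))) (m : Fin (n + 1) → ℕ)
    (σ : Fin (n + 1) → ℕ → GaGm n) (hσ : ∀ c ∈ good, ∀ i, coord (σ c i) c ≠ coord (1 : GaGm n) c) :
    (∏ c ∈ good, ∏ i ∈ Finset.range (m c),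
        (X c - C (coord (σ c i) c) : MvPolynomial (Fin (n + 1)) ℂ)) ∉ vanishing (H : Set (GaGm n)) := by
  intro hF
  have h := (evalAt_sectionPoly_eq_zero_iff good m σ 1).mp (hF 1 H.one_mem)
  obtain ⟨c, hc, i, -, hi⟩ := h
  exact hσ c hc i hi.symm

end GaGm

end Literature.NumberTheory.Transcendental
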